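import Literature.NumberTheory.LFunctions.ZetaLogDerivSeries
import Literature.NumberTheory.LFunctions.GeneralizedRH
import Literature.Analysis.SpecialFunctions.DigammaGauss
import Mathlib.Analysis.SpecialFunctions.Log.Summable
import HarnessLib

/-!
# Levinson–Montgomery's sign lemmas for `Re ζ'/ζ` (LM 1974, §2, (2.1)–(2.4))

Trunk T-ANT (NumberTheory/LFunctions). Leaf C3 of the decomposition of `Literature.NumberTheory.LFunctions.speiser_iff`
(`Literature/NumberTheory/LFunctions/RHClassicalEquivalents.lean`, rh.S18) along
Levinson–Montgomery, *Zeros of the derivatives of the Riemann zeta-function*, Acta Math. 133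
(1974), §2. With (2.1)
`Re ζ'/ζ(s) = -Re 1/(s-1) + ½ log π - ½ Re Γ'/Γ(s/2+1) + I`, `I = Σ' Re 1/(s-ρ)`,
Levinson–Montgomery observe (2.2)–(2.3) that, pairing `ρ = β + iγ` (`β < ½`) with `1 - β + iγ`,
the pair term `(σ-β)/((σ-β)²+(t-γ)²) + (σ-1+β)/((σ-1+β)²+(t-γ)²)` is negative on `σ = 0`,
vanishes on `σ = ½`, and is negative for `0 < σ < ½` whenever `(t-γ)² > (σ-β)(1-β-σ)`, while the
terms with `β = ½` are negative for `σ < ½`; and by Stirling (2.4) the `Γ`-part is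
`-½ log(t/2π) + O(1/t)`, negative for `t ≥ 10`. Hence `Re ζ'/ζ < 0` on `σ = 0` (`t ≥ 10`), on the
lines `t = T` at distance `≥ ½` from the ordinates of the zeros off the critical line, and
(Titchmarsh's variant of the right edge, *The Theory of the Riemann Zeta-Function* (1986) §10.28,
(10.28.5)–(10.28.6)) on `σ = ½ - δ`, `10 ≤ |t| ≤ T`, for `0 < δ ≤ δ₀(T)`.

Everything in this file is PROVED; the sign theorems take Hadamard data `P : XiProduct` for
`G(w²) = ξ(½+w)` as an argument (the partial fraction (2.1) is the tree's
`Literature.NumberTheory.LFunctions.XiProduct.logDeriv_riemannZeta`); such data exists by `XiProduct.ofHadamard`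
and the tree's `Literature.Analysis.Complex.hadamard_genus_zero_holds`. The Stirling-type bound is
`Literature.Analysis.SpecialFunctions.Complex.log_norm_sub_le_re_digamma`.

## Main results

* `Literature.RH.lmGammaRe s = -Re 1/(s-1) + ½ log π - ½ Re ψ(s/2+1)`; `lmGammaRe_le`,
  `lmGammaRe_lt_neg` : `lmGammaRe s < -1/10` for `σ ≥ 0`, `|t| ≥ 10` (LM (2.4)).
* `Literature.NumberTheory.LFunctions.lmPair_eq` — the factorisation
  `lmPair σ β u = -(1-2σ)(u² + (½-σ)² - (½-β)²)/(((σ-β)²+u²)((σ-1+β)²+u²))` and the sign facts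
  `lmPair_neg`, `lmPair_neg_of_re_zero` (σ = 0), `lmPair_neg_of_half_le_abs` (`|u| ≥ ½`),
  `lmPair_neg_of_beta_half` (`β = ½`), `lmPair_le_of_right` (`σ = ½-δ`: `≤ 4δ/(β-½)²`) (LM (2.2)–(2.3)).
* `Literature.NumberTheory.LFunctions.XiProduct.logDeriv_riemannZeta'` — (2.1) on `{Re s > 0} ∪ {Im s ≠ 0}` (the tree's version
  assumes `Re s > 0`); `XiProduct.term`, `XiProduct.re_logDeriv_riemannZeta_eq` — its real part
  `Re ζ'/ζ(s) = lmGammaRe s + Σₙ Re termₙ(s)`; `XiProduct.re_term_eq` (`Re termₙ = ½(lmPair + lmPair)`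
  at heights `∓γₙ`), `re_term_nonpos_of_re_zero`, `re_term_nonpos_of_good`, `re_term_le_of_right`.
* `Literature.RH.lmGood t` — "`t` is at distance `≥ ½` from the ordinate of every zero off the line".
* **Sign theorems**: `re_logDeriv_riemannZeta_neg_of_re_zero` (left edge `σ = 0`, `|t| ≥ 10`),
  `re_logDeriv_riemannZeta_neg_of_lmGood` (good heights, `0 ≤ σ < ½`),
  `exists_delta_re_logDeriv_riemannZeta_neg` (right edge `σ = ½-δ`, `10 ≤ |t| ≤ T`).
* `Literature.NumberTheory.LFunctions.exists_zero_near_of_not_lmGood` — a bad height has a zero `β+iγ`, `0 < β < ½`,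
  `|t-γ| < ½` (LM §2: "if `I ≥ 0` for some `t ≥ 10`, `0 < σ < ½`, there is a `ρ = β+iγ`
  such that `β < ½`, `(t-γ)² < …`").

## References

* N. Levinson, H. L. Montgomery, *Zeros of the derivatives of the Riemann zeta-function*, Acta
  Math. 133 (1974), 49–65, §2, eqs. (2.1)–(2.4).
* E. C. Titchmarsh, *The Theory of the Riemann Zeta-Function*, 2nd ed. (rev. D. R. Heath-Brown),
  OUP 1986, §10.28.
-/

noncomputable section

open Complex Filter Topology Set
open scoped Real ComplexConjugate

namespace Literature.NumberTheory.LFunctions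

/-! ## The `Γ`-part of (2.1) and its sign for `|t| ≥ 10` (LM (2.4)) -/

/-- The `Γ`-part of Levinson–Montgomery (2.1):
`M(s) = -Re 1/(s-1) + ½ log π - ½ Re Γ'/Γ(s/2 + 1)`. [cite: LevinsonMontgomery1974, §2 eq. (2.1)] -/
def lmGammaRe (s : ℂ) : ℝ :=
  -(1 / (s - 1)).re + Real.log π / 2 - (Complex.digamma (s / 2 + 1)).re / 2

/-- `½ log π ≤ π/(2e) < 0.578`. [folklore] -/
lemma half_log_pi_le : Real.log π / 2 ≤ 289 / 500 := by
  have he := Real.exp_one_gt_d9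
  have hπ := Real.pi_lt_d4
  have h1 : Real.log π ≤ π / Real.exp 1 := by
    have hpos : 0 < π / Real.exp 1 := div_pos Real.pi_pos (Real.exp_pos 1)
    have := Real.log_le_sub_one_of_pos hpos
    rw [Real.log_div Real.pi_pos.ne' (Real.exp_pos 1).ne', Real.log_exp] at this
    linarith
  have h2 : π / Real.exp 1 ≤ 3.1416 / 2.7182818283 :=
    div_le_div₀ (by norm_num) hπ.le (by norm_num) he.le
  have h3 : (3.1416 : ℝ) / 2.7182818283 ≤ 1156 / 1000 := by norm_num
  linarith

/-- `log 10 ≥ 2.279` (`log 10 = 3 log 2 + log (5/4)`, `log(5/4) ≥ 1 - 4/5`). [folklore] -/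
lemma log_ten_ge : (2279 / 1000 : ℝ) ≤ Real.log 10 := by
  have h2 := Real.log_two_gt_d9
  have h54 : (1 : ℝ) / 5 ≤ Real.log (5 / 4) := by
    have := Real.one_sub_inv_le_log_of_pos (by norm_num : (0 : ℝ) < 5 / 4)
    norm_num at this ⊢
    linarith
  have : Real.log 10 = 3 * Real.log 2 + Real.log (5 / 4) := by
    rw [show (10 : ℝ) = 2 ^ 3 * (5 / 4) by norm_num, Real.log_mul (by norm_num) (by norm_num),
      Real.log_pow]
    push_cast; ring
  rw [this]
  norm_num at h2
  linarith

/-- The pole term: `-Re 1/(s-1) = (1-σ)/((1-σ)² + t²) ≤ 1/100` for `σ ≥ 0`, `|t| ≥ 10`. [folklore] -/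
lemma neg_re_one_div_sub_one_le {s : ℂ} (h0 : 0 ≤ s.re) (ht : 10 ≤ |s.im|) :
    -(1 / (s - 1)).re ≤ 1 / 100 := by
  rw [re_one_div_sub]
  simp only [one_re, one_im, sub_zero]
  have ht2 : 100 ≤ s.im ^ 2 := by nlinarith [abs_nonneg s.im, sq_abs s.im]
  have hden : 0 < (s.re - 1) ^ 2 + s.im ^ 2 := by positivity
  have key : -(1 / 100) * ((s.re - 1) ^ 2 + s.im ^ 2) ≤ s.re - 1 := by nlinarith
  have := (le_div_iff₀ hden).2 key
  linarith

/-- **The `Γ`-part is `≤ 1.0232 - ½ log |t|`** for `Re s ≥ 0`, `|Im s| ≥ 10`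
(Levinson–Montgomery (2.4): `= -½ log(t/2π) + O(1/t)`). Ingredients: `-Re 1/(s-1) ≤ 1/100`,
`½ log π < 0.578`, and `Re ψ(w) ≥ log ‖w‖ - 1/(2‖w‖²) - π/(4 |Im w|)`
(`Literature.Analysis.SpecialFunctions.Complex.log_norm_sub_le_re_digamma`) with `w = s/2 + 1`, `‖w‖ ≥ |Im w| = |t|/2 ≥ 5`.
[cite: LevinsonMontgomery1974, §2 eq. (2.4)] -/
theorem lmGammaRe_le {s : ℂ} (h0 : 0 ≤ s.re) (ht : 10 ≤ |s.im|) :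
    lmGammaRe s ≤ 1279 / 1250 - Real.log |s.im| / 2 := by
  set w : ℂ := s / 2 + 1 with hw
  have hwre : w.re = s.re / 2 + 1 := by simp [hw]
  have hwim : w.im = s.im / 2 := by simp [hw]
  have hwre_pos : 0 < w.re := by rw [hwre]; linarith
  have hwim_abs : |w.im| = |s.im| / 2 := by rw [hwim, abs_div, abs_two]
  have hwim_ne : w.im ≠ 0 := by
    intro h; rw [h, abs_zero] at hwim_abs; linarith [abs_nonneg s.im]
  have hy5 : 5 ≤ |w.im| := by rw [hwim_abs]; linarith
  have hnorm : |w.im| ≤ ‖w‖ := Complex.abs_im_le_norm w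
  have hnorm5 : 5 ≤ ‖w‖ := hy5.trans hnorm
  have hψ := Literature.Analysis.SpecialFunctions.Complex.log_norm_sub_le_re_digamma hwre_pos hwim_ne
  have hlogw : Real.log |s.im| - Real.log 2 ≤ Real.log ‖w‖ := by
    rw [← Real.log_div (by linarith [abs_nonneg s.im]) two_ne_zero, ← hwim_abs]
    exact Real.log_le_log (by linarith) hnorm
  have hA : 1 / (2 * ‖w‖ ^ 2) ≤ 1 / 50 := by
    rw [div_le_div_iff₀ (by positivity) (by norm_num)]
    nlinarith
  have hB : π / (4 * |w.im|) ≤ 1571 / 10000 := by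
    rw [div_le_div_iff₀ (by positivity) (by norm_num)]
    have := Real.pi_lt_d4
    norm_num at this
    nlinarith
  have hP := neg_re_one_div_sub_one_le h0 ht
  have hl2 := Real.log_two_lt_d9
  norm_num at hl2
  have hπ := half_log_pi_le
  have hgoal : lmGammaRe s =
      -(1 / (s - 1)).re + Real.log π / 2 - (Complex.digamma w).re / 2 := rfl
  rw [hgoal]
  linarith

/-- **LM (2.4), sign form**: `-Re 1/(s-1) + ½ log π - ½ Re Γ'/Γ(s/2+1) < -1/10` for
`σ ≥ 0`, `|t| ≥ 10`. [cite: LevinsonMontgomery1974, §2 eq. (2.4)] -/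
theorem lmGammaRe_lt_neg {s : ℂ} (h0 : 0 ≤ s.re) (ht : 10 ≤ |s.im|) :
    lmGammaRe s < -1 / 10 := by
  have h := lmGammaRe_le h0 ht
  have hlog : Real.log 10 ≤ Real.log |s.im| := Real.log_le_log (by norm_num) ht
  have h10 := log_ten_ge
  linarith

/-! ## The pair terms (LM (2.2)–(2.3)) -/

/-- **Factorisation of the pair term**: with `x = σ-β`, `y = σ-1+β`,
`x/(x²+u²) + y/(y²+u²) = (x+y)(xy+u²)/((x²+u²)(y²+u²))` and `x + y = -(1-2σ)`,
`xy + u² = u² + (½-σ)² - (½-β)²`. [cite: LevinsonMontgomery1974, §2 eq. (2.2)–(2.3)] -/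
theorem lmPair_eq {σ β u : ℝ} (h₁ : (σ - β) ^ 2 + u ^ 2 ≠ 0) (h₂ : (σ - 1 + β) ^ 2 + u ^ 2 ≠ 0) :
    lmPair σ β u = -(1 - 2 * σ) * (u ^ 2 + (1 / 2 - σ) ^ 2 - (1 / 2 - β) ^ 2) /
      (((σ - β) ^ 2 + u ^ 2) * ((σ - 1 + β) ^ 2 + u ^ 2)) := by
  rw [lmPair, div_add_div _ _ h₁ h₂]
  congr 1
  ring

/-- **Sign of the pair term**: for `σ < ½` and `u² + (½-σ)² > (½-β)²` the pair term is negative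
(the two denominators are then automatically non-zero). This contains LM's (2.3): for
`0 < σ < ½` the term is negative iff `(t-γ)² > (σ-β)(1-β-σ) = (½-β)² - (½-σ)²`.
[cite: LevinsonMontgomery1974, §2 eq. (2.3)] -/
theorem lmPair_neg {σ β u : ℝ} (hσ : σ < 1 / 2)
    (h : (1 / 2 - β) ^ 2 < u ^ 2 + (1 / 2 - σ) ^ 2) : lmPair σ β u < 0 := by
  have h₁ : (σ - β) ^ 2 + u ^ 2 ≠ 0 := by
    intro h0
    have hu : u = 0 := by nlinarith
    have hx : σ = β := by nlinarith
    rw [hu, hx] at h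
    linarith
  have h₂ : (σ - 1 + β) ^ 2 + u ^ 2 ≠ 0 := by
    intro h0
    have hu : u = 0 := by nlinarith
    have hx : σ - 1 + β = 0 := by nlinarith
    have : 1 / 2 - β = -(1 / 2 - σ) := by linarith
    rw [hu, this] at h
    linarith
  have hD : 0 < ((σ - β) ^ 2 + u ^ 2) * ((σ - 1 + β) ^ 2 + u ^ 2) :=
    lt_of_le_of_ne (by positivity) (mul_ne_zero h₁ h₂).symm
  rw [lmPair_eq h₁ h₂, div_neg_iff]
  right
  refine ⟨?_, hD⟩
  have : 0 < 1 - 2 * σ := by linarith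
  nlinarith

/-- On `σ = 0` every pair term is negative (`0 < β < 1`): LM (2.2), "if `σ = 0` in the above
then already `I₁ < 0` with no further restriction on `t`". [cite: LevinsonMontgomery1974, §2 eq. (2.2)] -/
theorem lmPair_neg_of_re_zero {β u : ℝ} (hβ0 : 0 < β) (hβ1 : β < 1) : lmPair 0 β u < 0 := by
  refine lmPair_neg (by norm_num) ?_
  have : (1 / 2 - β) ^ 2 < (1 / 2 - 0) ^ 2 := by nlinarith
  nlinarith [sq_nonneg u]

/-- At distance `|u| ≥ ½` from the ordinate, every pair term with `0 < β < 1` is negative for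
`σ < ½` (LM §2: the terms with `(t-γ)² ≥ ¼ > (β-½)²`). [cite: LevinsonMontgomery1974, §2 eq. (2.3)] -/
theorem lmPair_neg_of_half_le_abs {σ β u : ℝ} (hσ : σ < 1 / 2) (hβ0 : 0 < β) (hβ1 : β < 1)
    (hu : 1 / 2 ≤ |u|) : lmPair σ β u < 0 := by
  refine lmPair_neg hσ ?_
  have h1 : (1 / 2 - β) ^ 2 < (1 / 2) ^ 2 := by nlinarith
  have h2 : (1 / 2 : ℝ) ^ 2 ≤ u ^ 2 := by
    calc (1 / 2 : ℝ) ^ 2 ≤ |u| ^ 2 := by gcongr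
      _ = u ^ 2 := sq_abs u
  nlinarith [sq_nonneg (1 / 2 - σ)]

/-- The terms with `β = ½` are negative for `σ < ½`: `I₂ = Σ (σ-½)/((σ-½)²+(t-γ)²) < 0`
(LM §2). [cite: LevinsonMontgomery1974, §2 eq. (2.2)] -/
theorem lmPair_neg_of_beta_half {σ u : ℝ} (hσ : σ < 1 / 2) : lmPair σ (1 / 2) u < 0 := by
  refine lmPair_neg hσ ?_
  have : 0 < (1 / 2 - σ) ^ 2 := by
    have : 0 < 1 / 2 - σ := by linarith
    positivity
  nlinarith [sq_nonneg u]

/-- **The right edge `σ = ½ - δ`** (Titchmarsh (10.28.5)–(10.28.6) made quantitative): for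
`0 < δ ≤ |β-½|/2` the pair term at `σ = ½-δ` is at most `4δ/(β-½)²` (it is
`-2δ(u² + δ² - (½-β)²)/D`, non-positive unless `u² < (½-β)² - δ²`, and then
`D ≥ ((½-β)² - δ²)² ≥ (9/16)(½-β)⁴`). [cite: Titchmarsh1986, §10.28 eq. (10.28.5)] -/
theorem lmPair_le_of_right {δ β u : ℝ} (hδ : 0 < δ) (hβ : β ≠ 1 / 2)
    (hδβ : δ ≤ |β - 1 / 2| / 2) : lmPair (1 / 2 - δ) β u ≤ 4 * δ / (β - 1 / 2) ^ 2 := by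
  have hσ : 1 / 2 - δ < 1 / 2 := by linarith
  have hp : 0 < (β - 1 / 2) ^ 2 := by
    have : β - 1 / 2 ≠ 0 := sub_ne_zero.2 hβ
    positivity
  have hbound : 0 ≤ 4 * δ / (β - 1 / 2) ^ 2 := by positivity
  by_cases hcase : (1 / 2 - β) ^ 2 < u ^ 2 + (1 / 2 - (1 / 2 - δ)) ^ 2
  · exact (lmPair_neg hσ hcase).le.trans hbound
  rw [not_lt] at hcase
  have hcase' : u ^ 2 + δ ^ 2 ≤ (1 / 2 - β) ^ 2 := by
    have : (1 / 2 - (1 / 2 - δ)) ^ 2 = δ ^ 2 := by ring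
    linarith [this]
  -- `δ² ≤ p²/4`
  have hδ2 : δ ^ 2 ≤ (β - 1 / 2) ^ 2 / 4 := by
    have h1 : δ ^ 2 ≤ (|β - 1 / 2| / 2) ^ 2 := by gcongr
    rw [div_pow, sq_abs] at h1
    linarith
  have hx : ((1 / 2 - δ) - β) ^ 2 + u ^ 2 ≠ 0 := by
    intro h0
    have hu : u = 0 := by nlinarith
    have h' : (1 / 2 - δ) - β = 0 := by nlinarith
    have : (β - 1 / 2) ^ 2 = δ ^ 2 := by nlinarith
    nlinarith
  have hy : ((1 / 2 - δ) - 1 + β) ^ 2 + u ^ 2 ≠ 0 := by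
    intro h0
    have hu : u = 0 := by nlinarith
    have h' : (1 / 2 - δ) - 1 + β = 0 := by nlinarith
    have : (β - 1 / 2) ^ 2 = δ ^ 2 := by nlinarith
    nlinarith
  rw [lmPair_eq hx hy]
  -- write `p² = (β-½)²`; the denominator is at least `(p² - δ²)²`
  set p2 : ℝ := (β - 1 / 2) ^ 2 with hp2
  have hp2' : (1 / 2 - β) ^ 2 = p2 := by rw [hp2]; ring
  have hD : (p2 - δ ^ 2) ^ 2 ≤ (((1 / 2 - δ) - β) ^ 2 + u ^ 2) * (((1 / 2 - δ) - 1 + β) ^ 2 + u ^ 2) := by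
    have hu2 : 0 ≤ u ^ 2 := sq_nonneg u
    have e : (p2 - δ ^ 2) ^ 2 = ((1 / 2 - δ) - β) ^ 2 * ((1 / 2 - δ) - 1 + β) ^ 2 := by
      rw [hp2]; ring
    rw [e]
    have ha : 0 ≤ ((1 / 2 - δ) - β) ^ 2 := sq_nonneg _
    have hb : 0 ≤ ((1 / 2 - δ) - 1 + β) ^ 2 := sq_nonneg _
    gcongr <;> linarith
  have hD0 : 0 < (((1 / 2 - δ) - β) ^ 2 + u ^ 2) * (((1 / 2 - δ) - 1 + β) ^ 2 + u ^ 2) := by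
    rcases (mul_nonneg (add_nonneg (sq_nonneg _) (sq_nonneg u))
      (add_nonneg (sq_nonneg _) (sq_nonneg u))).eq_or_lt with h | h
    · exact absurd h.symm (mul_ne_zero hx hy)
    · exact h
  have hlow : 9 / 16 * p2 ^ 2 ≤ (p2 - δ ^ 2) ^ 2 := by nlinarith
  -- numerator: `-(1-2σ)(u²+δ²-p²) = 2δ (p² - δ² - u²) ≤ 2δ p²`
  have hnum : -(1 - 2 * (1 / 2 - δ)) * (u ^ 2 + (1 / 2 - (1 / 2 - δ)) ^ 2 - (1 / 2 - β) ^ 2) ≤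
      2 * δ * p2 := by
    rw [hp2']
    nlinarith [sq_nonneg u, sq_nonneg δ]
  rw [div_le_div_iff₀ hD0 hp]
  calc -(1 - 2 * (1 / 2 - δ)) * (u ^ 2 + (1 / 2 - (1 / 2 - δ)) ^ 2 - (1 / 2 - β) ^ 2) * p2
      ≤ 2 * δ * p2 * p2 := by gcongr
    _ = 4 * δ * (9 / 16 * p2 ^ 2) * (8 / 9) := by ring
    _ ≤ 4 * δ * ((p2 - δ ^ 2) ^ 2) * (8 / 9) := by gcongr
    _ ≤ 4 * δ * ((((1 / 2 - δ) - β) ^ 2 + u ^ 2) * (((1 / 2 - δ) - 1 + β) ^ 2 + u ^ 2)) * 1 := by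
        gcongr; norm_num
    _ = 4 * δ * ((((1 / 2 - δ) - β) ^ 2 + u ^ 2) * (((1 / 2 - δ) - 1 + β) ^ 2 + u ^ 2)) := by ring

/-- Every pair term is bounded above by `0` or by the right-edge bound; a uniform crude bound is
not needed below, but non-positivity away from the exceptional window is:
for `σ < ½`, `0 < β < 1`, `β ≠ ½` and `|u| ≥ ½`, or `β = ½`, the term is `≤ 0`. [folklore] -/
theorem lmPair_nonpos_of_good {σ β u : ℝ} (hσ : σ < 1 / 2) (hβ0 : 0 < β) (hβ1 : β < 1)
    (h : β = 1 / 2 ∨ 1 / 2 ≤ |u|) : lmPair σ β u ≤ 0 := by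
  rcases h with h | h
  · rw [h]; exact (lmPair_neg_of_beta_half hσ).le
  · exact (lmPair_neg_of_half_le_abs hσ hβ0 hβ1 h).le

/-! ## (2.1) off the positive reals and its real part -/

/-- `s/2` is not a pole of `Γ` when `Re s > 0` or `Im s ≠ 0`. [folklore] -/
lemma half_ne_neg_nat {s : ℂ} (hs : 0 < s.re ∨ s.im ≠ 0) (m : ℕ) : s / 2 ≠ -m := by
  intro h
  have hre := congrArg Complex.re h
  have him := congrArg Complex.im h
  simp at hre him
  rcases hs with hs | hs
  · have : (0 : ℝ) ≤ m := m.cast_nonneg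
    linarith
  · exact hs him

/-- `Γℝ(s) ≠ 0` when `Re s > 0` or `Im s ≠ 0`. [folklore] -/
lemma Gammaℝ_ne_zero_of_re_pos_or_im_ne {s : ℂ} (hs : 0 < s.re ∨ s.im ≠ 0) : Gammaℝ s ≠ 0 := by
  rw [Ne, Gammaℝ_eq_zero_iff]
  rintro ⟨n, hn⟩
  exact half_ne_neg_nat hs n (by rw [hn]; ring)

namespace XiProduct

variable (P : XiProduct)

/-- **Levinson–Montgomery (2.1)** on the region `{Re s > 0} ∪ {Im s ≠ 0}` (which contains the
line `σ = 0`, `t ≠ 0` needed for the left edge of LM's contour): for `ζ(s) ≠ 0`, `s ≠ 1`,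
`ζ'/ζ(s) = Σₙ ½(T(bₙ,s) + T(b̄ₙ,s)) - 1/(s-1) + ½ log π - ½ ψ(s/2 + 1)`. Same proof as the
tree's `XiProduct.logDeriv_riemannZeta` (`ξ = ½ s(s-1) Γℝ(s) ζ(s)` near `s`).
[cite: LevinsonMontgomery1974, §2 eq. (2.1)] -/
theorem logDeriv_riemannZeta' {s : ℂ} (hζ : riemannZeta s ≠ 0) (hs1 : s ≠ 1)
    (hs : 0 < s.re ∨ s.im ≠ 0) :
    logDeriv riemannZeta s =
      ∑' n, (xiTerm (P.b n) s + xiTerm (starRingEnd ℂ (P.b n)) s) / 2 -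
        1 / (s - 1) + (Real.log Real.pi : ℂ) / 2 - Complex.digamma (s / 2 + 1) / 2 := by
  have hs0 : s ≠ 0 := by
    rintro rfl
    simp at hs
  have hΓ : Gammaℝ s ≠ 0 := Gammaℝ_ne_zero_of_re_pos_or_im_ne hs
  have hξ : riemannXi s ≠ 0 := fun h ↦ hζ (riemannZeta_eq_zero_of_riemannXi_eq_zero h).2.2
  have hpole : ∀ m : ℕ, s / 2 ≠ -m := half_ne_neg_nat hs
  -- `ξ = F · ζ` near `s`, with `F(z) = ½ z (z-1) Γℝ(z)`
  set F : ℂ → ℂ := fun z ↦ z * (z - 1) / 2 * Gammaℝ z with hF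
  have hev : riemannXi =ᶠ[𝓝 s] fun z ↦ F z * riemannZeta z := by
    have ho : IsOpen {z : ℂ | (0 < z.re ∨ z.im ≠ 0) ∧ z ≠ 1} :=
      ((isOpen_lt continuous_const continuous_re).union
        (isOpen_ne_fun continuous_im continuous_const)).inter isOpen_ne
    filter_upwards [ho.mem_nhds ⟨hs, hs1⟩] with z hz
    have hz0 : z ≠ 0 := by
      rintro rfl
      simp at hz
    have hΓz : Gammaℝ z ≠ 0 := Gammaℝ_ne_zero_of_re_pos_or_im_ne hz.1
    rw [riemannXi_eq_mul_completedRiemannZeta hz0 hz.2, riemannZeta_def_of_ne_zero hz0, hF]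
    field_simp
  have hFs : F s ≠ 0 := by
    have : F s = s * (s - 1) / 2 * Gammaℝ s := rfl
    rw [this]
    exact mul_ne_zero (div_ne_zero (mul_ne_zero hs0 (sub_ne_zero.2 hs1)) two_ne_zero) hΓ
  have hdΓ : DifferentiableAt ℂ Gammaℝ s := (RealZeros.hasDerivAt_Gammaℝ hpole).differentiableAt
  have hdF : DifferentiableAt ℂ F s := by simp only [hF]; fun_prop
  have hdζ : DifferentiableAt ℂ riemannZeta s := differentiableAt_riemannZeta hs1
  have hpoly : logDeriv (fun z : ℂ ↦ z * (z - 1) / 2) s = 1 / s + 1 / (s - 1) := by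
    rw [logDeriv_apply]
    have hd : HasDerivAt (fun z : ℂ ↦ z * (z - 1) / 2) ((1 * (s - 1) + s * 1) / 2) s :=
      ((hasDerivAt_id' s).fun_mul ((hasDerivAt_id' s).sub_const 1)).div_const 2
    rw [hd.deriv]
    have hs1' : s - 1 ≠ 0 := sub_ne_zero.2 hs1
    field_simp
  have hlogF : logDeriv F s =
      1 / s + 1 / (s - 1) + (-(Complex.log π) / 2 + Complex.digamma (s / 2) / 2) := by
    simp only [hF]
    rw [logDeriv_mul (f := fun z : ℂ ↦ z * (z - 1) / 2) (g := Gammaℝ) s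
      (div_ne_zero (mul_ne_zero hs0 (sub_ne_zero.2 hs1)) two_ne_zero) hΓ
      (by fun_prop) hdΓ, hpoly, logDeriv_Gammaℝ hpole]
  have hmain : logDeriv riemannXi s = logDeriv F s + logDeriv riemannZeta s := by
    rw [logDeriv_congr_of_eventuallyEq hev,
      logDeriv_mul (f := F) (g := riemannZeta) s hFs hζ hdF hdζ]
  have hψ : Complex.digamma (s / 2 + 1) = Complex.digamma (s / 2) + (s / 2)⁻¹ :=
    Complex.digamma_apply_add_one (s / 2) hpole
  have hlogpi : Complex.log π = ((Real.log Real.pi : ℝ) : ℂ) :=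
    (Complex.ofReal_log Real.pi_pos.le).symm
  obtain ⟨hsym, -⟩ := P.logDeriv_riemannXi_symm hξ
  rw [hlogF, hsym] at hmain
  rw [hψ]
  rw [hlogpi] at hmain
  have hs2 : s / 2 ≠ 0 := div_ne_zero hs0 two_ne_zero
  linear_combination (norm := skip) -hmain
  field_simp
  ring

/-- The `n`-th term of the symmetrised expansion, `½(T(bₙ,s) + T(b̄ₙ,s))`. [folklore] -/
def term (s : ℂ) (n : ℕ) : ℂ := (xiTerm (P.b n) s + xiTerm (starRingEnd ℂ (P.b n)) s) / 2

/-- Unfolding of `term`. [folklore] -/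
lemma term_def (s : ℂ) (n : ℕ) :
    P.term s n = (xiTerm (P.b n) s + xiTerm (starRingEnd ℂ (P.b n)) s) / 2 := rfl

/-- The terms with `bₙ = 0` (padding) vanish. [folklore] -/
lemma term_eq_zero {s : ℂ} {n : ℕ} (hn : P.b n = 0) : P.term s n = 0 := by
  simp [term, xiTerm, hn]

/-- The terms are summable where `ξ ≠ 0`. [folklore] -/
lemma summable_term {s : ℂ} (hξ : riemannXi s ≠ 0) : Summable (P.term s) :=
  (P.logDeriv_riemannXi_symm hξ).2

/-- **Real part of (2.1)**: for `ζ(s) ≠ 0`, `s ≠ 1`, `Re s > 0` or `Im s ≠ 0`,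
`Re ζ'/ζ(s) = M(s) + Σₙ Re ½(T(bₙ,s) + T(b̄ₙ,s))`, `M = lmGammaRe`, and the real series converges.
[cite: LevinsonMontgomery1974, §2 eq. (2.1)] -/
theorem re_logDeriv_riemannZeta_eq {s : ℂ} (hζ : riemannZeta s ≠ 0) (hs1 : s ≠ 1)
    (hs : 0 < s.re ∨ s.im ≠ 0) :
    (logDeriv riemannZeta s).re = lmGammaRe s + ∑' n, (P.term s n).re ∧
      Summable fun n ↦ (P.term s n).re := by
  have hξ : riemannXi s ≠ 0 := fun h ↦ hζ (riemannZeta_eq_zero_of_riemannXi_eq_zero h).2.2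
  have hsum := P.summable_term hξ
  have hsum_re : Summable fun n ↦ (P.term s n).re := by
    simpa using hsum.mapL Complex.reCLM
  refine ⟨?_, hsum_re⟩
  rw [P.logDeriv_riemannZeta' hζ hs1 hs]
  simp only [sub_re, add_re, Complex.div_ofNat_re, Complex.ofReal_re, lmGammaRe]
  have : (∑' n, (xiTerm (P.b n) s + xiTerm (starRingEnd ℂ (P.b n)) s) / 2).re =
      ∑' n, (P.term s n).re := by
    rw [show (fun n ↦ (xiTerm (P.b n) s + xiTerm (starRingEnd ℂ (P.b n)) s) / 2) = P.term s
      from rfl, Complex.re_tsum hsum]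
  rw [this]
  ring

/-- The four zeros of `ζ` attached to `bₙ ≠ 0`: `ρₙ, 1-ρₙ, ρ̄ₙ, 1-ρ̄ₙ`. [folklore] -/
theorem zeros_of_ne_zero {n : ℕ} (hn : P.b n ≠ 0) :
    riemannZeta (P.zero n) = 0 ∧ riemannZeta (1 - P.zero n) = 0 ∧
      riemannZeta (starRingEnd ℂ (P.zero n)) = 0 ∧
      riemannZeta (1 - starRingEnd ℂ (P.zero n)) = 0 := by
  obtain ⟨h0, hre, -⟩ := P.zero_spec hn
  have h1 : riemannZeta (1 - P.zero n) = 0 := LevinsonMontgomery.riemannZeta_one_sub_eq_zero hre h0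
  refine ⟨h0, h1, by rw [riemannZeta_conj, h0, map_zero], ?_⟩
  have : 1 - starRingEnd ℂ (P.zero n) = starRingEnd ℂ (1 - P.zero n) := by simp
  rw [this, riemannZeta_conj, h1, map_zero]

/-- **Real part of a term = two Levinson–Montgomery pair terms** (heights `γₙ` and `-γₙ`, weight
`½` each), at every `s` with `ζ(s) ≠ 0` (so `s` is none of the four poles of the term).
[cite: LevinsonMontgomery1974, §2 eq. (2.2)] -/
theorem re_term_eq {s : ℂ} (hζ : riemannZeta s ≠ 0) {n : ℕ} (hn : P.b n ≠ 0) :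
    (P.term s n).re = (lmPair s.re (P.zero n).re (s.im - (P.zero n).im) +
      lmPair s.re (P.zero n).re (s.im + (P.zero n).im)) / 2 := by
  obtain ⟨h1, h2, h3, h4⟩ := P.zeros_of_ne_zero hn
  exact re_xiTerm_add_conj hn (P.zero_sub_half_sq n)
    (fun h ↦ hζ (h ▸ h1)) (fun h ↦ hζ (h ▸ h2)) (fun h ↦ hζ (h ▸ h3)) (fun h ↦ hζ (h ▸ h4))

/-- On `σ = 0` every term has non-positive real part (LM (2.2) for `σ = 0`; both pair terms are
negative, padding terms vanish). [cite: LevinsonMontgomery1974, §2 eq. (2.2)] -/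
theorem re_term_nonpos_of_re_zero {s : ℂ} (hζ : riemannZeta s ≠ 0) (hre : s.re = 0) (n : ℕ) :
    (P.term s n).re ≤ 0 := by
  by_cases hn : P.b n = 0
  · rw [P.term_eq_zero hn, zero_re]
  rw [P.re_term_eq hζ hn, hre]
  obtain ⟨-, hβ0, hβ1⟩ := P.zero_spec hn
  have := lmPair_neg_of_re_zero (u := s.im - (P.zero n).im) hβ0 hβ1
  have := lmPair_neg_of_re_zero (u := s.im + (P.zero n).im) hβ0 hβ1
  linarith

/-- For `σ < ½`, a term whose zero is on the critical line, or whose ordinates `±γₙ` are both at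
distance `≥ ½` from `t`, has non-positive real part (LM (2.3) and the sign of `I₂`).
[cite: LevinsonMontgomery1974, §2 eq. (2.3)] -/
theorem re_term_nonpos_of_good {s : ℂ} (hζ : riemannZeta s ≠ 0) (hσ : s.re < 1 / 2) (n : ℕ)
    (hgood : P.b n ≠ 0 → (P.zero n).re ≠ 1 / 2 →
      1 / 2 ≤ |s.im - (P.zero n).im| ∧ 1 / 2 ≤ |s.im + (P.zero n).im|) :
    (P.term s n).re ≤ 0 := by
  by_cases hn : P.b n = 0
  · rw [P.term_eq_zero hn, zero_re]
  rw [P.re_term_eq hζ hn]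
  obtain ⟨-, hβ0, hβ1⟩ := P.zero_spec hn
  by_cases hβ : (P.zero n).re = 1 / 2
  · have h₁ := lmPair_nonpos_of_good (u := s.im - (P.zero n).im) hσ hβ0 hβ1 (Or.inl hβ)
    have h₂ := lmPair_nonpos_of_good (u := s.im + (P.zero n).im) hσ hβ0 hβ1 (Or.inl hβ)
    linarith
  · obtain ⟨hu₁, hu₂⟩ := hgood hn hβ
    have h₁ := lmPair_nonpos_of_good hσ hβ0 hβ1 (Or.inr hu₁)
    have h₂ := lmPair_nonpos_of_good hσ hβ0 hβ1 (Or.inr hu₂)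
    linarith

/-- On the right edge `σ = ½ - δ`, an exceptional term (`βₙ ≠ ½`, `0 < δ ≤ |βₙ-½|/2`) has real
part at most `4δ/(βₙ-½)²`. [cite: Titchmarsh1986, §10.28 eq. (10.28.5)] -/
theorem re_term_le_of_right {s : ℂ} {δ : ℝ} (hζ : riemannZeta s ≠ 0) (hre : s.re = 1 / 2 - δ)
    (hδ : 0 < δ) {n : ℕ} (hn : P.b n ≠ 0) (hβ : (P.zero n).re ≠ 1 / 2)
    (hδβ : δ ≤ |(P.zero n).re - 1 / 2| / 2) :
    (P.term s n).re ≤ 4 * δ / ((P.zero n).re - 1 / 2) ^ 2 := by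
  rw [P.re_term_eq hζ hn, hre]
  have h₁ := lmPair_le_of_right (u := s.im - (P.zero n).im) hδ hβ hδβ
  have h₂ := lmPair_le_of_right (u := s.im + (P.zero n).im) hδ hβ hδβ
  linarith

end XiProduct

/-! ## Good heights and the sign theorems -/

/-- **Levinson–Montgomery's good heights**: `t` is *good* if it is at distance `≥ ½` from the
ordinate of every zero of `ζ` in the critical strip off the critical line. (At a good height
`t ≥ 10`, `Re ζ'/ζ(σ+it) < 0` for `0 ≤ σ < ½`; at a bad height there is a zero `β + iγ` with
`β < ½`, `|t-γ| < ½`, LM §2.) [cite: LevinsonMontgomery1974, §2] -/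
def lmGood (t : ℝ) : Prop :=
  ∀ ρ : ℂ, riemannZeta ρ = 0 → 0 < ρ.re → ρ.re < 1 → ρ.re ≠ 1 / 2 → 1 / 2 ≤ |t - ρ.im|

/-- A good height is also at distance `≥ ½` from `-γ` for every zero `β+iγ` off the line
(conjugate zero). [folklore] -/
lemma lmGood.half_le_abs_add {t : ℝ} (h : lmGood t) {ρ : ℂ} (h0 : riemannZeta ρ = 0)
    (h1 : 0 < ρ.re) (h2 : ρ.re < 1) (h3 : ρ.re ≠ 1 / 2) : 1 / 2 ≤ |t + ρ.im| := by
  have := h (starRingEnd ℂ ρ) (by rw [riemannZeta_conj, h0, map_zero]) (by simpa using h1)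
    (by simpa using h2) (by simpa using h3)
  simpa using this

/-- `-t` is good when `t` is. [folklore] -/
lemma lmGood.neg {t : ℝ} (h : lmGood t) : lmGood (-t) := by
  intro ρ h0 h1 h2 h3
  have := h.half_le_abs_add h0 h1 h2 h3
  rwa [← abs_neg, neg_add, ← sub_eq_add_neg] at this

/-- The hypothesis of `XiProduct.re_term_nonpos_of_good` holds at every term when the height is
good. [folklore] -/
lemma lmGood.term_hyp {s : ℂ} (h : lmGood s.im) (P : XiProduct) (n : ℕ) (hn : P.b n ≠ 0)
    (hβ : (P.zero n).re ≠ 1 / 2) :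
    1 / 2 ≤ |s.im - (P.zero n).im| ∧ 1 / 2 ≤ |s.im + (P.zero n).im| := by
  obtain ⟨h0, hβ0, hβ1⟩ := P.zero_spec hn
  exact ⟨h _ h0 hβ0 hβ1 hβ, h.half_le_abs_add h0 hβ0 hβ1 hβ⟩

/-- `ζ(it) ≠ 0` for real `t ≠ 0` (functional equation; the tree's
`Literature.NumberTheory.LFunctions.riemannZeta_eq_zero_iff_of_re_nonpos`). [folklore] -/
theorem riemannZeta_ne_zero_of_re_zero {s : ℂ} (hre : s.re = 0) (him : s.im ≠ 0) :
    riemannZeta s ≠ 0 := by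
  rw [Ne, Literature.NumberTheory.LFunctions.riemannZeta_eq_zero_iff_of_re_nonpos hre.le]
  rintro ⟨n, hn⟩
  have := congrArg Complex.im hn
  simp at this
  exact him this

/-- At a good height there is no zero of `ζ` with `0 ≤ σ < ½` (such a zero would be at distance
`0` from its own ordinate). [folklore] -/
theorem riemannZeta_ne_zero_of_lmGood {s : ℂ} (h : lmGood s.im) (him : s.im ≠ 0) (h0 : 0 ≤ s.re)
    (h1 : s.re < 1 / 2) : riemannZeta s ≠ 0 := by
  rcases h0.eq_or_lt with h0 | h0
  · exact riemannZeta_ne_zero_of_re_zero h0.symm him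
  · intro hz
    have := h s hz h0 (by linarith) (by linarith)
    simp at this
    linarith

/-- A series with non-positive terms off a finite set is bounded by its sum over that set. [folklore] -/
lemma tsum_le_sum_of_nonpos {f : ℕ → ℝ} (hf : Summable f) (F : Finset ℕ)
    (h : ∀ n ∉ F, f n ≤ 0) : ∑' n, f n ≤ ∑ n ∈ F, f n := by
  have := hf.neg.sum_le_tsum F (fun n hn ↦ by simpa using h n hn)
  rw [tsum_neg, Finset.sum_neg_distrib] at this
  linarith

/-- **Left edge** (LM §2: "by (2.4) and since `I < 0`, `Re ζ'/ζ(it) < 0` for `|t| ≥ 10`"):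
`Re ζ'/ζ(it) < 0` for `|t| ≥ 10`. [cite: LevinsonMontgomery1974, §2] -/
theorem re_logDeriv_riemannZeta_neg_of_re_zero (P : XiProduct) {s : ℂ} (hre : s.re = 0)
    (ht : 10 ≤ |s.im|) : (logDeriv riemannZeta s).re < 0 := by
  have him : s.im ≠ 0 := by
    intro h; rw [h, abs_zero] at ht; linarith
  have hζ := riemannZeta_ne_zero_of_re_zero hre him
  have hs1 : s ≠ 1 := by
    intro h; rw [h] at hre; simp at hre
  obtain ⟨heq, hsum⟩ := P.re_logDeriv_riemannZeta_eq hζ hs1 (Or.inr him)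
  have hM := lmGammaRe_lt_neg hre.symm.le ht
  have hS : ∑' n, (P.term s n).re ≤ 0 :=
    tsum_nonpos fun n ↦ P.re_term_nonpos_of_re_zero hζ hre n
  rw [heq]
  linarith

/-- **Good heights** (LM §2: at a height `t ≥ 10` at distance `≥ ½` from the ordinates of the
zeros off the line, all pair terms are `≤ 0`, so `Re ζ'/ζ(σ+it) < 0` for `0 ≤ σ < ½`).
[cite: LevinsonMontgomery1974, §2] -/
theorem re_logDeriv_riemannZeta_neg_of_lmGood (P : XiProduct) {s : ℂ} (hgood : lmGood s.im)
    (ht : 10 ≤ |s.im|) (h0 : 0 ≤ s.re) (h1 : s.re < 1 / 2) :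
    (logDeriv riemannZeta s).re < 0 := by
  have him : s.im ≠ 0 := by
    intro h; rw [h, abs_zero] at ht; linarith
  have hζ := riemannZeta_ne_zero_of_lmGood hgood him h0 h1
  have hs1 : s ≠ 1 := by
    intro h; rw [h] at h1; norm_num at h1
  obtain ⟨heq, hsum⟩ := P.re_logDeriv_riemannZeta_eq hζ hs1 (Or.inr him)
  have hM := lmGammaRe_lt_neg h0 ht
  have hS : ∑' n, (P.term s n).re ≤ 0 :=
    tsum_nonpos fun n ↦ P.re_term_nonpos_of_good hζ h1 n (hgood.term_hyp P n)
  rw [heq]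
  linarith

/-- **A bad height has a zero nearby, to the left of the line** (LM §2: "if `I ≥ 0` for some
`t ≥ 10`, `0 < σ < ½`, there is a `ρ = β + iγ` such that `β < ½`,
`(t-γ)² < (σ-β)(1-σ-β) < (β-½)²`"; in our normalisation, `|t - γ| < ½`, using the symmetry
`ρ ↦ 1 - ρ̄` of the zeros). [cite: LevinsonMontgomery1974, §2] -/
theorem exists_zero_near_of_not_lmGood {t : ℝ} (h : ¬ lmGood t) :
    ∃ ρ : ℂ, riemannZeta ρ = 0 ∧ 0 < ρ.re ∧ ρ.re < 1 / 2 ∧ |t - ρ.im| < 1 / 2 := by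
  simp only [lmGood, not_forall, not_le, exists_prop] at h
  obtain ⟨ρ, h0, h1, h2, h3, h4⟩ := h
  rcases lt_or_gt_of_ne h3 with h3 | h3
  · exact ⟨ρ, h0, h1, h3, h4⟩
  · refine ⟨1 - starRingEnd ℂ ρ, ?_, ?_, ?_, ?_⟩
    · have : 1 - starRingEnd ℂ ρ = starRingEnd ℂ (1 - ρ) := by simp
      rw [this, riemannZeta_conj, LevinsonMontgomery.riemannZeta_one_sub_eq_zero h1 h0, map_zero]
    · simp; linarith
    · simp; linarith
    · simpa using h4

/-! ## The right edge `σ = ½ - δ` -/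

/-- The zeros attached to small `bₙ` are high: `γₙ² ≥ 1/‖bₙ‖ - 1/4`
(`|ρₙ - ½|² = 1/‖bₙ‖` and `|βₙ - ½| < ½`). [folklore] -/
lemma XiProduct.inv_norm_sub_le_sq_im (P : XiProduct) {n : ℕ} (hn : P.b n ≠ 0) :
    1 / ‖P.b n‖ - 1 / 4 ≤ (P.zero n).im ^ 2 := by
  obtain ⟨-, hβ0, hβ1⟩ := P.zero_spec hn
  have h1 : ‖P.zero n - 1 / 2‖ ^ 2 = 1 / ‖P.b n‖ := by
    rw [← norm_pow, P.zero_sub_half_sq, norm_inv, one_div]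
  have h2 : ‖P.zero n - 1 / 2‖ ^ 2 = ((P.zero n).re - 1 / 2) ^ 2 + (P.zero n).im ^ 2 := by
    rw [Complex.sq_norm, Complex.normSq_apply]
    simp
    ring
  have h3 : ((P.zero n).re - 1 / 2) ^ 2 ≤ 1 / 4 := by nlinarith
  linarith

/-- A positive lower bound for finitely many positive reals. [folklore] -/
lemma exists_pos_le_of_finset {ι : Type*} (F : Finset ι) (f : ι → ℝ) (hf : ∀ i ∈ F, 0 < f i) :
    ∃ δ : ℝ, 0 < δ ∧ ∀ i ∈ F, δ ≤ f i := by
  classical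
  by_cases hF : F.Nonempty
  · obtain ⟨i₀, hi₀, hmin⟩ := F.exists_min_image f hF
    exact ⟨f i₀, hf i₀ hi₀, hmin⟩
  · exact ⟨1, one_pos, fun i hi ↦ absurd ⟨i, hi⟩ hF⟩

/-- **Right edge** (Titchmarsh's form of LM's contour, (10.28.5)–(10.28.6), made explicit): for
every `T` there is `δ₀ ∈ (0, ¼]` such that `Re ζ'/ζ(½ - δ + it) < 0` whenever `0 < δ ≤ δ₀` and
`10 ≤ |t| ≤ T`. Proof: the terms with `βₙ = ½` and the (cofinitely many) terms with
`|γₙ| > T + 1` are `≤ 0`; each of the finitely many remaining terms is `≤ 4δ/(βₙ-½)²` once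
`δ ≤ |βₙ-½|/2`; and the `Γ`-part is `< -1/10`. (`δ₀` is also taken smaller than the distance to
`σ = ½` of the finitely many zeros of `ζ` with `¼ ≤ β < ½`, `|γ| ≤ T`.)
[cite: Titchmarsh1986, §10.28 eq. (10.28.5)–(10.28.6)] -/
theorem exists_delta_re_logDeriv_riemannZeta_neg (P : XiProduct) (T : ℝ) :
    ∃ δ₀ : ℝ, 0 < δ₀ ∧ δ₀ ≤ 1 / 4 ∧ ∀ δ : ℝ, 0 < δ → δ ≤ δ₀ → ∀ s : ℂ, s.re = 1 / 2 - δ →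
      10 ≤ |s.im| → |s.im| ≤ T → (logDeriv riemannZeta s).re < 0 := by
  classical
  -- (1) cofinitely many `bₙ` are small, hence their zeros are high
  set r : ℝ := 1 / ((|T| + 1) ^ 2 + 1) with hr
  have hr0 : 0 < r := by positivity
  have hb0 : Tendsto (fun n ↦ ‖P.b n‖) atTop (𝓝 0) := by
    simpa using P.summable_norm.tendsto_atTop_zero
  obtain ⟨N₀, hN₀⟩ := eventually_atTop.1 (hb0.eventually (gt_mem_nhds hr0))
  have hhigh : ∀ n, N₀ ≤ n → P.b n ≠ 0 → |T| + 1 < |(P.zero n).im| := by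
    intro n hn hb
    have h1 := P.inv_norm_sub_le_sq_im hb
    have h2 : ‖P.b n‖ < r := hN₀ n hn
    have h3 : (|T| + 1) ^ 2 + 1 < 1 / ‖P.b n‖ := by
      rw [hr] at h2
      have hbpos : 0 < ‖P.b n‖ := norm_pos_iff.2 hb
      rw [lt_div_iff₀ hbpos]
      rw [lt_div_iff₀ (by positivity)] at h2
      linarith
    have h4 : (|T| + 1) ^ 2 < |(P.zero n).im| ^ 2 := by rw [sq_abs]; linarith
    exact lt_of_pow_lt_pow_left₀ 2 (abs_nonneg _) h4
  -- (2) the exceptional finite set and `δ₁ ≤ |βₙ - ½|/2` on it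
  set F : Finset ℕ := (Finset.range N₀).filter
    (fun n ↦ P.b n ≠ 0 ∧ (P.zero n).re ≠ 1 / 2) with hF
  obtain ⟨δ₁, hδ₁, hδ₁F⟩ := exists_pos_le_of_finset F (fun n ↦ |(P.zero n).re - 1 / 2| / 2)
    (fun n hn ↦ by
      rw [hF, Finset.mem_filter] at hn
      have : (P.zero n).re - 1 / 2 ≠ 0 := sub_ne_zero.2 hn.2.2
      positivity)
  set S : ℝ := ∑ n ∈ F, 4 / ((P.zero n).re - 1 / 2) ^ 2 with hS
  have hS0 : 0 ≤ S := Finset.sum_nonneg fun n _ ↦ by positivity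
  -- (3) the zeros of `ζ` with `¼ ≤ β < ½`, `0 < γ ≤ |T|`
  set Z : Finset ℂ := (Literature.NumberTheory.LFunctions.zetaZeroBox_finite (1 / 4) |T|).toFinset.filter
    (fun ρ ↦ ρ.re < 1 / 2) with hZ
  obtain ⟨δ₂, hδ₂, hδ₂Z⟩ := exists_pos_le_of_finset Z (fun ρ ↦ 1 / 2 - ρ.re)
    (fun ρ hρ ↦ by
      rw [hZ, Finset.mem_filter] at hρ
      linarith [hρ.2])
  have hZmem : ∀ ρ : ℂ, riemannZeta ρ = 0 → 1 / 4 ≤ ρ.re → ρ.re < 1 / 2 → 0 < ρ.im →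
      ρ.im ≤ |T| → δ₂ ≤ 1 / 2 - ρ.re := by
    intro ρ h0 h1 h2 h3 h4
    apply hδ₂Z
    rw [hZ, Finset.mem_filter, Set.Finite.mem_toFinset]
    exact ⟨⟨h0, h1, by linarith, h3, h4⟩, h2⟩
  -- (4) the choice of `δ₀`
  refine ⟨min (min δ₁ (δ₂ / 2)) (min (1 / 4) (1 / (10 * (S + 1)))), by positivity,
    (min_le_right _ _).trans (min_le_left _ _), ?_⟩
  intro δ hδ hδ₀ s hre ht htT
  have hδ₁' : δ ≤ δ₁ := hδ₀.trans ((min_le_left _ _).trans (min_le_left _ _))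
  have hδ₂' : δ < δ₂ := by
    have := hδ₀.trans ((min_le_left _ _).trans (min_le_right _ _))
    linarith
  have hδ4 : δ ≤ 1 / 4 := hδ₀.trans ((min_le_right _ _).trans (min_le_left _ _))
  have hδS : δ ≤ 1 / (10 * (S + 1)) := hδ₀.trans ((min_le_right _ _).trans (min_le_right _ _))
  have hT : |s.im| ≤ |T| := htT.trans (le_abs_self T)
  have him : s.im ≠ 0 := by
    intro h; rw [h, abs_zero] at ht; linarith
  have hs1 : s ≠ 1 := by
    intro h; rw [h] at hre; simp at hre; linarith
  -- `ζ(s) ≠ 0`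
  have hζ : riemannZeta s ≠ 0 := by
    intro h0
    rcases lt_or_gt_of_ne him with hneg | hpos
    · have h0' : riemannZeta (starRingEnd ℂ s) = 0 := by rw [riemannZeta_conj, h0, map_zero]
      have := hZmem (starRingEnd ℂ s) h0' (by simp; linarith) (by simp; linarith)
        (by simpa using hneg) (by simpa [abs_of_neg hneg] using hT)
      simp at this
      linarith
    · have := hZmem s h0 (by linarith) (by linarith) hpos (by simpa [abs_of_pos hpos] using hT)
      linarith
  obtain ⟨heq, hsum⟩ := P.re_logDeriv_riemannZeta_eq hζ hs1 (Or.inl (by linarith))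
  have hM := lmGammaRe_lt_neg (s := s) (by linarith) ht
  -- terms off `F` are `≤ 0`
  have hoff : ∀ n ∉ F, (P.term s n).re ≤ 0 := by
    intro n hn
    refine P.re_term_nonpos_of_good hζ (by linarith) n fun hb hβ ↦ ?_
    have hnN : N₀ ≤ n := by
      by_contra hlt
      exact hn (by rw [hF, Finset.mem_filter, Finset.mem_range]; exact ⟨by omega, hb, hβ⟩)
    have hγ := hhigh n hnN hb
    have ha : |s.im - (P.zero n).im| ≥ |(P.zero n).im| - |s.im| := by
      have := abs_sub_abs_le_abs_sub (P.zero n).im s.im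
      rw [abs_sub_comm] at this
      linarith
    have hb' : |s.im + (P.zero n).im| ≥ |(P.zero n).im| - |s.im| := by
      have := abs_add_le (s.im + (P.zero n).im) (-s.im)
      rw [abs_neg, add_neg_cancel_comm] at this
      linarith
    constructor <;> linarith [abs_nonneg T]
  -- terms on `F` are `≤ 4δ/(βₙ-½)²`
  have hon : ∀ n ∈ F, (P.term s n).re ≤ δ * (4 / ((P.zero n).re - 1 / 2) ^ 2) := by
    intro n hn
    have hn' := hn
    rw [hF, Finset.mem_filter] at hn'
    have := P.re_term_le_of_right hζ hre hδ hn'.2.1 hn'.2.2 (hδ₁'.trans (hδ₁F n hn))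
    calc (P.term s n).re ≤ 4 * δ / ((P.zero n).re - 1 / 2) ^ 2 := this
      _ = δ * (4 / ((P.zero n).re - 1 / 2) ^ 2) := by ring
  have hsum_le : ∑' n, (P.term s n).re ≤ δ * S := by
    calc ∑' n, (P.term s n).re ≤ ∑ n ∈ F, (P.term s n).re := tsum_le_sum_of_nonpos hsum F hoff
      _ ≤ ∑ n ∈ F, δ * (4 / ((P.zero n).re - 1 / 2) ^ 2) := Finset.sum_le_sum hon
      _ = δ * S := by rw [hS, Finset.mul_sum]
  have hδS' : δ * S < 1 / 10 := by
    calc δ * S ≤ 1 / (10 * (S + 1)) * S := by gcongr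
      _ < 1 / 10 := by
        rw [div_mul_eq_mul_div, div_lt_div_iff₀ (by positivity) (by norm_num)]
        nlinarith
  rw [heq]
  linarith

end Literature.NumberTheory.LFunctions

end
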